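import Literature.Probability.Percolation.SlabGluingFact2ConnectorAt
import HarnessLib

/-!
# DST 2016, §2.3, Fact 2 — connector at the end of `γ_min` with a witness next to `Z_n`

Topic: `Literature/Probability/Percolation`. Towards the verbatim discharge of
`DuminilCopinSidoraviciusTassion2016_fact2` (`SlabGluing.lean`): a third instance of the connector
surgery at the last vertex `e = (h_e, (3n, r))` of `γ_min(ω)` (`SlabGluingFact2ConnectorAt.lean`), for
a (P2)-witness `x₀` over the column `(3n - 1, r₀)` NEXT TO a cell `(3n, r₀)` of `Z_n`, `r₀ ≠ r`:
the corridor runs inside `Z̄_n` (which `γ_min` meets only at `e`) from the neighbour `(3n, r ± 1)` of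
`e` to `(3n, r₀)` at the height of `e`, steps to `(3n - 1, r₀)`, and climbs to `x₀`. This covers the
point `z = planar(e)` of `U(ω)` with a DIAGONAL witness on the `Z_n` side (`r₀ = r ± 1`), and the
points near the ends of `Z_n` whose witness sits in the column `3n - 1` beside `Z_n` near `e`.

* `GlueGeom.exists_surgOut_end_Zcol` — PROVED: a located surgery output of radius `R ≥ 1` at
  `planar(e)` whenever `|r₀ - r| ≤ R`.

## Sources

* H. Duminil-Copin, V. Sidoravicius, V. Tassion, *Absence of infinite cluster for critical
  Bernoulli percolation on slabs*, CPAM 69 (2016), arXiv:1401.7130, §2.3, proof of Fact 2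
  (pp. 6–7).
-/

noncomputable section

namespace Literature.Probability.Percolation

open LatticeModels SimpleGraph

variable {k : ℕ}

namespace GlueGeom

variable {G : GlueGeom} {ω : BondConfig (slab 3 k)}

/-- PROVED — **located surgery at the end of `γ_min`, witness beside `Z_n`**: for `ω ∈ 𝒳` a
lattice configuration and a (P2)-witness `x₀` over `(3n - 1, r₀)` with `(3n, r₀) ∈ Z_n`, `r₀ ≠ r`
(`r` the row of the last vertex `e` of `γ_min(ω)`), `|r₀ - r| ≤ R`, `R ≥ 1`: a located surgery output of
radius `R` at `planar(e)` exists. [cite: DuminilCopinSidoraviciusTassion2016, §2.3, proof of Fact 2 (pp. 6–7)] -/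
theorem exists_surgOut_end_Zcol (hG : G.InRange) (hω : ω ⊆ (slabGraph 3 k).edgeSet) (hX : ω ∈ G.evX k)
    {x₀ s' : slab 3 k} (hs' : s' ∈ slabLift k G.src')
    (hπ : ω ∈ openConnIn (slabLift k G.small ∩ {v | planar k v ∉ G.γcols k ω}) x₀ s')
    (hx₀1 : (planar k x₀).1 = 3 * G.n - 1) (hx₀Z : ((3 * (G.n : ℤ)), (planar k x₀).2) ∈ G.zSeg)
    (hx₀r : (planar k x₀).2 ≠ (planar k ((G.γmin k ω).getLast (G.γmin_spec k hX.1.1.1).1.ne_nil)).2)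
    {R : ℕ} (hR1 : 1 ≤ R)
    (hR : |(planar k x₀).2 - (planar k ((G.γmin k ω).getLast (G.γmin_spec k hX.1.1.1).1.ne_nil)).2| ≤ R) :
    ∃ ω', G.SurgOut k R ω (planar k ((G.γmin k ω).getLast (G.γmin_spec k hX.1.1.1).1.ne_nil)) ω' := by
  have hA : ω ∈ G.evA k := hX.1.1.1
  have hγO := (G.γmin_spec k hA).1
  obtain ⟨hn, hu₃, hu₁, hα, hαn, hy0, hy⟩ := id hG
  set γ := G.γmin k ω with hγdef
  set e := γ.getLast hγO.ne_nil with he_def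
  set q₀ := planar k x₀ with hq₀
  obtain ⟨hx₀S, hs'S, hreach⟩ := hπ
  have hq₀s : q₀ ∈ G.small := hx₀S.1
  have hq₀γ : q₀ ∉ G.γcols k ω := hx₀S.2
  have heZ := G.getLast_mem_zSeg (k := k) (ω := ω) hA
  have heb : planar k e ∈ G.big := hγO.subset e (List.getLast_mem _)
  have heq₀ : planar k e ≠ q₀ := fun h => hq₀γ ⟨e, List.getLast_mem _, h⟩
  -- coordinates: `e = (3n, r)`, `q₀ = (3n - 1, r₀)`, `r ≠ r₀`, `(3n, r₀) ∈ Z_n`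
  set r := (planar k e).2 with hr
  set r₀ := q₀.2 with hr₀
  have he1 : (planar k e).1 = 3 * G.n := by
    simp only [zSeg, sideSeg, Set.mem_setOf_eq] at heZ; exact heZ.1
  have hq₀eq : q₀ = (3 * (G.n : ℤ) - 1, r₀) := Prod.ext hx₀1 rfl
  have heeq : planar k e = (3 * (G.n : ℤ), r) := Prod.ext he1 rfl
  have hrr₀ : r ≠ r₀ := fun h => hx₀r h.symm
  set p₀ : ℤ × ℤ := (3 * (G.n : ℤ), r₀) with hp₀
  have hrZ : G.y - G.α ≤ r ∧ r ≤ G.y + G.α := by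
    simp only [zSeg, sideSeg, Set.mem_setOf_eq] at heZ; exact heZ.2
  have hr₀Z : G.y - G.α ≤ r₀ ∧ r₀ ≤ G.y + G.α := by
    have := hx₀Z; simp only [zSeg, sideSeg, Set.mem_setOf_eq] at this; exact this.2
  have hrb : -(3 * (G.n : ℤ)) ≤ r ∧ r ≤ 3 * G.n := by
    simp only [big, sqBox, Set.mem_setOf_eq, abs_le, Prod.snd_zero, sub_zero] at heb; exact heb.2
  have hr₀s : G.y - G.n ≤ r₀ ∧ r₀ ≤ G.y + G.n := by
    simp only [small, sqBox, Set.mem_setOf_eq, abs_le] at hq₀s; constructor <;> omega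
  obtain ⟨-, hq₀src, hq₀src'⟩ := G.end_coords (k := k) (ω := ω) hG hA hq₀s (by rw [hq₀eq])
  -- the planar piece inside `Z_n`: rows from `r₁` (next to `r`, towards `r₀`) to `r₀`
  obtain ⟨r₁, hr₁facts⟩ : ∃ r₁ : ℤ, (r₁ = r + 1 ∧ r < r₀) ∨ (r₁ = r - 1 ∧ r₀ < r) := by
    rcases lt_or_gt_of_ne hrr₀ with h | h
    · exact ⟨r + 1, Or.inl ⟨rfl, h⟩⟩
    · exact ⟨r - 1, Or.inr ⟨rfl, h⟩⟩
  have hr₁adj : planarAdj (planar k e) (3 * (G.n : ℤ), r₁) := by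
    rw [heeq, planarAdj]
    rcases hr₁facts with ⟨h1, -⟩ | ⟨h1, -⟩
    · rw [h1]; right; left; ext <;> simp
    · rw [h1]; right; right; ext <;> simp
  obtain ⟨lpl, hlpl, hlplm⟩ := exists_vpath (3 * (G.n : ℤ)) r₁ r₀
  have hrows : ∀ q ∈ lpl, q.1 = 3 * G.n ∧ q.2 ≠ r ∧
      G.y - G.α ≤ q.2 ∧ q.2 ≤ G.y + G.α ∧ min r r₀ ≤ q.2 ∧ q.2 ≤ max r r₀ := by
    intro q hq
    obtain ⟨h1, h2, h3⟩ := (hlplm q).1 hq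
    simp only [min_le_iff, le_max_iff] at h2 h3 ⊢
    rcases hr₁facts with ⟨h4, h5⟩ | ⟨h4, h5⟩ <;> rw [h4] at h2 h3 <;> refine ⟨h1, ?_, ?_, ?_, ?_, ?_⟩ <;> omega
  have hhe : ht e ≤ k := ht_le e
  have hh' : ht x₀ ≤ k := ht_le x₀
  have hXp := liftH_spath (k := k) hlpl (ht e)
  rw [← hp₀] at hXp
  have hmemX : ∀ v ∈ liftH k (ht e) lpl, planar k v ∈ lpl ∧ ht v = ht e := fun v hv =>
    (mem_liftH_iff hhe v).1 hv
  -- the step from `(3n, r₀)` to `q₀ = (3n - 1, r₀)`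
  have hpq : planarAdj p₀ q₀ := by
    rw [hq₀eq, hp₀, planarAdj]; left; right; ext <;> simp
  have hXc := hXp.concat (vtx_adj_vtx_planar (k := k) hpq (ht e)) fun hmem => by
    have := (hmemX _ hmem).1
    rw [planar_vtx] at this
    have := (hrows _ this).1
    rw [hq₀eq] at this
    simp only at this
    omega
  have hYp := vline_spath (k := k) q₀ hhe hh'
  rw [show vtx k q₀ (ht x₀) = x₀ from vtx_planar_ht x₀] at hYp
  have hmemY : ∀ v ∈ vline k q₀ (ht e) (ht x₀), planar k v = q₀ := fun v hv =>
    ((mem_vline_iff hhe hh' v).1 hv).1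
  obtain ⟨hC, hmemC⟩ := hXc.trans hYp fun v hvX hvY => by
    rcases List.mem_append.1 hvX with h | h
    · exfalso
      have h1 := (hrows _ (hmemX v h).1).1
      have h2 := hmemY v hvY
      rw [h2, hq₀eq] at h1
      simp only at h1
      omega
    · simpa using h
  set C := (liftH k (ht e) lpl ++ [vtx k q₀ (ht e)]) ++ (vline k q₀ (ht e) (ht x₀)).tail with hCdef
  -- planar bookkeeping along the corridor
  have hplan : ∀ v ∈ C, ((planar k v).1 = 3 * G.n ∧ (planar k v).2 ≠ r ∧
      G.y - G.n ≤ (planar k v).2 ∧ (planar k v).2 ≤ G.y + G.n ∧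
      min r r₀ ≤ (planar k v).2 ∧ (planar k v).2 ≤ max r r₀) ∨ planar k v = q₀ := by
    intro v hv
    rcases (hmemC v).1 hv with h | h
    · rcases List.mem_append.1 h with h | h
      · obtain ⟨h1, h2, h4, h5, h6, h7⟩ := hrows _ (hmemX v h).1
        exact Or.inl ⟨h1, h2, by omega, by omega, h6, h7⟩
      · right
        rw [List.mem_singleton] at h
        rw [h, planar_vtx]
    · exact Or.inr (hmemY v h)
  obtain ⟨π, hπO⟩ := exists_isOSAP_of_openConnIn
    (show ω ∈ openConnIn (slabLift k G.small ∩ {v | planar k v ∉ G.γcols k ω}) x₀ s' from ⟨hx₀S, hs'S, hreach⟩)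
  have hx₀π : x₀ ∈ π := by
    have := hπO.head_mem hπO.ne_nil
    rw [Set.mem_singleton_iff] at this
    rw [← this]; exact List.head_mem _
  have hcn := G.exists_connector_of_corridor hω hX (C := C) ?_ ?_ ?_ ?_ ?_ ?_ hs' hπO
    ⟨x₀, hC.last_mem, hx₀π⟩
  · obtain ⟨cn, hcng, hcnI⟩ := hcn
    have hg3 : planar k cn.g ∈ sqBox (planar k e) 3 := by
      rw [hcng]; change planar k e ∈ sqBox (planar k e) 3; simp [sqBox]
    have hIr : ∀ x ∈ cn.I, planar k x ∈ sqBox (planar k e) R := fun x hx => by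
      rcases hplan x (hcnI x hx) with ⟨h1, -, -, -, h6, h7⟩ | h1
      · simp only [sqBox, Set.mem_setOf_eq, h1, he1, sub_self, abs_zero, Nat.cast_nonneg, true_and]
        rw [abs_le] at hR ⊢
        simp only [min_le_iff, le_max_iff] at h6 h7
        constructor <;> omega
      · rw [h1, hq₀eq]
        simp only [sqBox, Set.mem_setOf_eq, he1, abs_le]
        rw [abs_le] at hR
        have hR1' : (1 : ℤ) ≤ R := by exact_mod_cast hR1
        refine ⟨⟨by omega, by omega⟩, ?_⟩
        change -(R : ℤ) ≤ r₀ - r ∧ r₀ - r ≤ R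
        change -(R : ℤ) ≤ (planar k x₀).2 - (planar k e).2 ∧ (planar k x₀).2 - (planar k e).2 ≤ R at hR
        exact hR
    exact ⟨_, cn.surgOut hX hg3 hIr⟩
  · -- `e :: C` is a lattice chain
    rw [List.isChain_cons]
    refine ⟨fun y hy => ?_, hC.chain⟩
    rw [hC.head, Option.mem_def, Option.some.injEq] at hy
    subst hy
    have := vtx_adj_vtx_planar (k := k) hr₁adj (ht e)
    rwa [vtx_planar_ht] at this
  · -- and self-avoiding
    rw [List.nodup_cons]
    refine ⟨fun h => ?_, hC.nodup⟩
    rcases hplan e h with h' | h'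
    · exact h'.2.1 rfl
    · exact heq₀ h'
  · -- off `γ_min`: inside `Z̄_n` a vertex of `γ_min` is `e`; the column of `x₀` is off `γ_min`
    intro v hv hvγ
    rcases (hmemC v).1 hv with h | h
    · rcases List.mem_append.1 h with h | h
      · obtain ⟨h1, h2, h4, h5, -⟩ := hrows _ (hmemX v h).1
        have hvZ : planar k v ∈ G.zSeg := by
          simp only [zSeg, sideSeg, Set.mem_setOf_eq]; exact ⟨h1, h4, h5⟩
        have := G.eq_getLast_of_mem_zSeg hA hvγ hvZ
        exact h2 (by rw [this])
      · rw [List.mem_singleton] at h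
        exact hq₀γ ⟨v, hvγ, by rw [h, planar_vtx]⟩
    · exact hq₀γ ⟨v, hvγ, hmemY v h⟩
  · -- inside the window
    intro v hv
    rw [mem_slabLift_iff]
    rcases hplan v hv with ⟨h1, -, h4, h5, h6, h7⟩ | h1
    · simp only [big, small, sqBox, Set.mem_union, Set.mem_setOf_eq, abs_le, Prod.fst_zero, Prod.snd_zero,
        sub_zero, h1]
      simp only [min_le_iff, le_max_iff] at h6 h7
      omega
    · rw [h1]; exact Or.inr hq₀s
  · -- off `S̄_{3n}`
    intro v hv h
    rw [mem_slabLift_iff] at h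
    rcases hplan v hv with ⟨h1, -⟩ | h1
    · simp only [src, sqBox, Set.mem_setOf_eq, abs_le, Prod.fst_zero, Prod.snd_zero, sub_zero, h1] at h
      omega
    · exact hq₀src (h1 ▸ h)
  · -- off `S̄'_n`
    intro v hv h
    rw [mem_slabLift_iff] at h
    rcases hplan v hv with ⟨h1, -⟩ | h1
    · simp only [src', sqBox, Set.mem_setOf_eq, abs_le, h1] at h
      omega
    · exact hq₀src' (h1 ▸ h)

end GlueGeom

end Literature.Probability.Percolation

end
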